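import Literature.NumberTheory.ComplexMultiplication.CMTypeRankTwoBlocksConverse
import Mathlib.Algebra.Order.BigOperators.Group.Finset
import HarnessLib

/-!
# Two-block CM types: rank additivity is detected by `ℕ`-valued weights (weights of monomials on POWERS), and
# balancedness pushes forward along equivariant maps of the index sets

Sequel of `NumberTheory/ComplexMultiplication/CMTypeRankTwoBlocksConverse`.  There: if rank additivity fails for the
glued CM type `Σ₁ ⊔ Σ₂` on `E₁ ⊔ E₂` — `rank(Σ₁ ⊔ Σ₂) + 1 < rank Σ₁ + rank Σ₂`, i.e. `Hg(X × Y) ⊊ Hg(X) × Hg(Y)` —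
then some RATIONAL weight `f : E₁ ⊔ E₂ → ℚ` is balanced for `Σ₁ ⊔ Σ₂` while one of its blocks `f ∘ inl`, `f ∘ inr`
is not (`exists_isBalanced_sum_not_isBalanced_of_typeRank_lt`).  A rational weight is not yet a cohomology class.
Here the witness is upgraded to an `ℕ`-VALUED weight (`exists_nat_isBalanced_sum_not_isBalanced_of_typeRank_lt`):
Pohlmann's condition is `ℚ`-linear in the weight and CONSTANT weights are balanced for a CM type (a CM type and its
complement have the same size), so `d • f + c` (clear denominators, add a large constant) is again glued-balanced
with an unbalanced block.  An `ℕ`-valued weight `g` on `⊔_i Hom(K_i, ℂ)` IS the multiplicity function of a monomial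
`u_S` in an eigenbasis of `H¹` of a product of COPIES of the `A_i` (`g(i,s)` slots over `i` carry `s`), i.e. of a
class on a power; whence (in `Pohlmann1968/HodgeClassesProductSpanCMProductsPowers`) an exceptional Hodge class on
some `X^k × Y^k` outside the span of exterior products — the direction of Moonen–Zarhin's (3.1) that was left open
in the tree.  Consequently (`typeRank_sum_add_one_eq_iff_forall_nat_isBalanced`)

  `rank(Σ₁ ⊔ Σ₂) + 1 = rank Σ₁ + rank Σ₂ ⟺ every ℕ-weight balanced for Σ₁ ⊔ Σ₂ has balanced blocks`.

Also proved, for the passage between an index set and the index set of a power (slot projections):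
`isBalanced_preimage_iff_fiberSum` — for a `G`-equivariant `σ : E' → E` and the pulled-back type `σ⁻¹Ψ`, a weight
`h` on `E'` is balanced for `σ⁻¹Ψ` iff its push-forward `y ↦ Σ_{σ z = y} h z` is balanced for `Ψ`.
Theorems only; no definition, no named fact; axioms `propext`, `Classical.choice`, `Quot.sound`.

## References
* [MoonenZarhin1999LowDim] B. Moonen, Yu. Zarhin, Math. Ann. 315 (1999) 711–733, §3 (3.1).
* [Gordon1999HodgeAVSurvey] B. B. Gordon, *A survey of the Hodge conjecture for abelian varieties*, 7.5–7.7, §9.2 (9.2.1).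
-/

set_option autoImplicit false

noncomputable section

open scoped BigOperators

namespace Literature.NumberTheory.ComplexMultiplication

variable {G : Type*} [Group G]

/-! ### §1 Pohlmann's condition is `ℚ`-linear in the weight; constants are balanced for a CM type -/

section Linear

variable {E : Type*} [MulAction G E] [Fintype E] {Φ : Set E}

/-- Sums of balanced weights are balanced (Pohlmann's condition (9.2.1) is additive in the multiplicities).
[cite: Gordon1999HodgeAVSurvey, §9.2 (9.2.1)] -/
theorem IsBalanced.add' {f f' : E → ℚ} (hf : IsBalanced G Φ f) (hf' : IsBalanced G Φ f') :
    IsBalanced G Φ (fun x => f x + f' x) := by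
  intro g
  have h1 := hf g
  have h2 := hf' g
  simp only [add_mul, Finset.sum_add_distrib]
  linarith

/-- Rational multiples of balanced weights are balanced. [cite: Gordon1999HodgeAVSurvey, §9.2 (9.2.1)] -/
theorem IsBalanced.const_mul {f : E → ℚ} (hf : IsBalanced G Φ f) (c : ℚ) :
    IsBalanced G Φ (fun x => c * f x) := by
  intro g
  have h1 := hf g
  simp only [mul_assoc, ← Finset.mul_sum]
  rw [mul_left_comm, h1]

/-- **A constant weight is balanced for a CM type**: every translate `g⁻¹Φ` of a CM type has exactly `|E|/2` points,
so `2 · c · |g⁻¹Φ| = c · |E|` (the case `f ∘ ρ = f` of `isBalanced_of_symm`). [cite: Gordon1999HodgeAVSurvey, §9.2 (9.2.1)] -/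
theorem IsCMTypeWith.isBalanced_const {ρ : G} (h : IsCMTypeWith ρ Φ) (c : ℚ) : IsBalanced G Φ (fun _ => c) :=
  h.isBalanced_of_symm (f := fun _ => c) fun _ => rfl

/-- If `x ↦ d · f x + c` is balanced for a CM type (`d ≠ 0`), so is `f`. [cite: Gordon1999HodgeAVSurvey, §9.2 (9.2.1)] -/
theorem IsCMTypeWith.isBalanced_of_isBalanced_mul_add {ρ : G} (h : IsCMTypeWith ρ Φ) {f : E → ℚ} {d c : ℚ}
    (hd : d ≠ 0) (hf : IsBalanced G Φ (fun x => d * f x + c)) : IsBalanced G Φ f := by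
  have h1 : IsBalanced G Φ (fun x => d⁻¹ * ((d * f x + c) - c)) :=
    (hf.sub (h.isBalanced_const c)).const_mul d⁻¹
  have h2 : (fun x => d⁻¹ * ((d * f x + c) - c)) = f := by
    funext x
    field_simp
    ring
  rwa [h2] at h1

/-- If `f` is balanced for a CM type then so is `x ↦ d · f x + c`. [cite: Gordon1999HodgeAVSurvey, §9.2 (9.2.1)] -/
theorem IsCMTypeWith.isBalanced_mul_add {ρ : G} (h : IsCMTypeWith ρ Φ) {f : E → ℚ} (d c : ℚ)
    (hf : IsBalanced G Φ f) : IsBalanced G Φ (fun x => d * f x + c) :=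
  (hf.const_mul d).add' (h.isBalanced_const c)

end Linear

/-! ### §2 Clearing denominators: every rational weight is `d⁻¹ (g − c)` for an `ℕ`-valued weight `g` -/

section Integral

variable {E : Type*} [Fintype E]

/-- **Every rational weight on a finite set is `x ↦ (g x − c) / d` for an `ℕ`-valued weight `g`**, a positive integer
`d` and a rational constant `c`: take `d = ∏_x den(f x)` (so `d · f x ∈ ℤ`) and shift by `c = Σ_x |d · f x|`. [folklore] -/
private theorem exists_nat_cast_eq_mul_add (f : E → ℚ) :
    ∃ (d : ℕ) (c : ℚ) (g : E → ℕ), 0 < d ∧ ∀ x, (g x : ℚ) = d * f x + c := by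
  classical
  -- `d · f x` is an integer for `d` the product of the denominators
  set d : ℕ := ∏ x, (f x).den with hd
  have hdpos : 0 < d := Finset.prod_pos fun x _ => (f x).den_pos
  have hint : ∀ x, ∃ z : ℤ, (d : ℚ) * f x = z := by
    intro x
    refine ⟨(∏ y ∈ Finset.univ.erase x, ((f y).den : ℤ)) * (f x).num, ?_⟩
    rw [hd, ← Finset.prod_erase_mul Finset.univ (fun y => (f y).den) (Finset.mem_univ x)]
    push_cast
    rw [mul_assoc, Rat.den_mul_eq_num]
  choose z hz using hint
  -- shift by `m = Σ |z_x|` to make everything non-negative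
  set m : ℤ := ∑ x, |z x| with hm
  have hnonneg : ∀ x, 0 ≤ z x + m := by
    intro x
    have h1 : |z x| ≤ m := Finset.single_le_sum (fun y _ => abs_nonneg (z y)) (Finset.mem_univ x)
    have h2 : -z x ≤ |z x| := neg_le_abs (z x)
    linarith
  refine ⟨d, (m : ℚ), fun x => (z x + m).toNat, hdpos, fun x => ?_⟩
  have h := Int.toNat_of_nonneg (hnonneg x)
  rw [show ((z x + m).toNat : ℚ) = (((z x + m).toNat : ℤ) : ℚ) from (Int.cast_natCast _).symm, h]
  push_cast
  rw [hz x]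

end Integral

/-! ### §3 Failure of rank additivity is detected by an `ℕ`-valued weight -/

section TwoBlocks

variable {E₁ E₂ : Type*} [MulAction G E₁] [MulAction G E₂] [Fintype E₁] [Fintype E₂]
  {Φ₁ : Set E₁} {Φ₂ : Set E₂} {ρ : G}

/-- **Failure of rank additivity produces an `ℕ`-valued glued-balanced weight with an unbalanced block.**  If
`rank(Σ₁ ⊔ Σ₂) + 1 < rank Σ₁ + rank Σ₂` (`Hg(X × Y) ⊊ Hg(X) × Hg(Y)`), there is `g : E₁ ⊔ E₂ → ℕ` — multiplicities of a
monomial on a product of copies — satisfying Pohlmann's condition for `Σ₁ ⊔ Σ₂` whose blocks `g ∘ inl`, `g ∘ inr` are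
NOT both balanced: the rational witness of `exists_isBalanced_sum_not_isBalanced_of_typeRank_lt`, denominators
cleared and shifted by a constant (constants are balanced for the CM types `Σ₁ ⊔ Σ₂`, `Σ₁`, `Σ₂`).
[cite: MoonenZarhin1999LowDim, §3 (3.1)] [cite: Gordon1999HodgeAVSurvey, 7.5 (1) ⟹ (3)] -/
theorem exists_nat_isBalanced_sum_not_isBalanced_of_typeRank_lt [Nonempty E₁] [Nonempty E₂]
    (h₁ : IsCMTypeWith ρ Φ₁) (h₂ : IsCMTypeWith ρ Φ₂)
    (hlt : typeRank G {z : E₁ ⊕ E₂ | Sum.elim (· ∈ Φ₁) (· ∈ Φ₂) z} + 1 < typeRank G Φ₁ + typeRank G Φ₂) :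
    ∃ g : E₁ ⊕ E₂ → ℕ, IsBalanced G {z : E₁ ⊕ E₂ | Sum.elim (· ∈ Φ₁) (· ∈ Φ₂) z} (fun z => (g z : ℚ)) ∧
      ¬ (IsBalanced G Φ₁ (fun x => (g (Sum.inl x) : ℚ)) ∧ IsBalanced G Φ₂ (fun y => (g (Sum.inr y) : ℚ))) := by
  obtain ⟨f, hf, hnot⟩ := exists_isBalanced_sum_not_isBalanced_of_typeRank_lt h₁ h₂ hlt
  obtain ⟨d, c, g, hd, hg⟩ := exists_nat_cast_eq_mul_add f
  have hd' : (d : ℚ) ≠ 0 := Nat.cast_ne_zero.2 hd.ne'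
  refine ⟨g, ?_, fun hbal => hnot ⟨?_, ?_⟩⟩
  · have h := (h₁.sum h₂).isBalanced_mul_add (d : ℚ) c hf
    rwa [show (fun z => (d : ℚ) * f z + c) = fun z => (g z : ℚ) from funext fun z => (hg z).symm] at h
  · refine h₁.isBalanced_of_isBalanced_mul_add hd' (c := c) ?_
    rw [show (fun x => (d : ℚ) * (f ∘ Sum.inl) x + c) = fun x => (g (Sum.inl x) : ℚ) from
      funext fun x => (hg (Sum.inl x)).symm]
    exact hbal.1
  · refine h₂.isBalanced_of_isBalanced_mul_add hd' (c := c) ?_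
    rw [show (fun y => (d : ℚ) * (f ∘ Sum.inr) y + c) = fun y => (g (Sum.inr y) : ℚ) from
      funext fun y => (hg (Sum.inr y)).symm]
    exact hbal.2

/-- **Rank additivity ⟺ the splitting principle for `ℕ`-weights.**  For CM types `Σ₁`, `Σ₂` on two `G`-sets:
`rank(Σ₁ ⊔ Σ₂) + 1 = rank Σ₁ + rank Σ₂` iff every `ℕ`-valued weight on `E₁ ⊔ E₂` balanced for the glued type has
balanced blocks — `ℕ`-weights being exactly the weights of monomials on products of copies, this is Moonen–Zarhin's
(3.1) "`Hg(X₁ × X₂) = Hg(X₁) × Hg(X₂)` iff all Hodge classes on all `X₁^k × X₂^l` come from the factors" on index sets.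
[cite: MoonenZarhin1999LowDim, §3 (3.1)] -/
theorem typeRank_sum_add_one_eq_iff_forall_nat_isBalanced [Nonempty E₁] [Nonempty E₂] (h₁ : IsCMTypeWith ρ Φ₁)
    (h₂ : IsCMTypeWith ρ Φ₂) :
    typeRank G {z : E₁ ⊕ E₂ | Sum.elim (· ∈ Φ₁) (· ∈ Φ₂) z} + 1 = typeRank G Φ₁ + typeRank G Φ₂ ↔
      ∀ g : E₁ ⊕ E₂ → ℕ, IsBalanced G {z : E₁ ⊕ E₂ | Sum.elim (· ∈ Φ₁) (· ∈ Φ₂) z} (fun z => (g z : ℚ)) →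
        IsBalanced G Φ₁ (fun x => (g (Sum.inl x) : ℚ)) ∧ IsBalanced G Φ₂ (fun y => (g (Sum.inr y) : ℚ)) := by
  constructor
  · intro hrank g hg
    exact ⟨isBalanced_inl_of_typeRank_sum_eq h₁ h₂ hrank hg, isBalanced_inr_of_typeRank_sum_eq h₁ h₂ hrank hg⟩
  · intro hsplit
    by_contra hne
    have hlt : typeRank G {z : E₁ ⊕ E₂ | Sum.elim (· ∈ Φ₁) (· ∈ Φ₂) z} + 1 < typeRank G Φ₁ + typeRank G Φ₂ :=
      lt_of_le_of_ne (typeRank_sum_add_one_le h₁ h₂) hne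
    obtain ⟨g, hg, hnot⟩ := exists_nat_isBalanced_sum_not_isBalanced_of_typeRank_lt h₁ h₂ hlt
    exact hnot (hsplit g hg)

end TwoBlocks

/-! ### §4 Balancedness pushes forward along equivariant maps (index sets of powers) -/

section PushForward

variable {E E' : Type*} [MulAction G E] [MulAction G E'] [Fintype E] [Fintype E']

omit [Fintype E] [Fintype E'] in
/-- The indicator of a translate of a pulled-back type `σ⁻¹Ψ` is the indicator of the translate of `Ψ` composed with
`σ`, for `σ` equivariant (`Φᵍ` as a characteristic function, transported along a map of index sets). [cite: Dodson1987, §1.1 (p. 50)] -/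
theorem translateInd_preimage {Ψ : Set E} {σ : E' → E} (hσ : ∀ (g : G) (z : E'), σ (g • z) = g • σ z) (g : G)
    (z : E') : translateInd {z : E' | σ z ∈ Ψ} g z = translateInd Ψ g (σ z) := by
  by_cases hz : g • σ z ∈ Ψ
  · rw [translateInd_of_mem hz, translateInd_of_mem (show g • z ∈ {z : E' | σ z ∈ Ψ} by
      rw [Set.mem_setOf_eq, hσ]; exact hz)]
  · rw [translateInd_of_not_mem hz, translateInd_of_not_mem (show g • z ∉ {z : E' | σ z ∈ Ψ} by
      rw [Set.mem_setOf_eq, hσ]; exact hz)]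

/-- **Balancedness pushes forward along equivariant maps.**  Let `σ : E' → E` be `G`-equivariant and `σ⁻¹Ψ ⊆ E'` the
pulled-back type (e.g. `E'` the embeddings of the CM algebra of a product of COPIES, `σ` the slot projection).  A weight
`h` on `E'` satisfies Pohlmann's condition for `σ⁻¹Ψ` iff its push-forward `y ↦ Σ_{σ z = y} h(z)` (the multiplicity
function, for `h` an indicator) satisfies it for `Ψ`. [cite: Gordon1999HodgeAVSurvey, §9.2 (9.2.1)] -/
theorem isBalanced_preimage_iff_fiberSum [DecidableEq E] (Ψ : Set E) {σ : E' → E}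
    (hσ : ∀ (g : G) (z : E'), σ (g • z) = g • σ z) (h : E' → ℚ) :
    IsBalanced G {z : E' | σ z ∈ Ψ} h ↔
      IsBalanced G Ψ (fun y => ∑ z ∈ Finset.univ.filter (fun z => σ z = y), h z) := by
  have hsum : ∑ y, ∑ z ∈ Finset.univ.filter (fun z => σ z = y), h z = ∑ z, h z :=
    Finset.sum_fiberwise Finset.univ σ h
  have hsum' : ∀ g : G, ∑ y, (∑ z ∈ Finset.univ.filter (fun z => σ z = y), h z) * translateInd Ψ g y =
      ∑ z, h z * translateInd {z : E' | σ z ∈ Ψ} g z := by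
    intro g
    rw [← Finset.sum_fiberwise Finset.univ σ (fun z => h z * translateInd {z : E' | σ z ∈ Ψ} g z)]
    refine Finset.sum_congr rfl fun y _ => ?_
    rw [Finset.sum_mul]
    refine Finset.sum_congr rfl fun z hz => ?_
    rw [translateInd_preimage hσ, (Finset.mem_filter.1 hz).2]
  refine forall_congr' fun g => ?_
  rw [hsum, hsum' g]

end PushForward

end Literature.NumberTheory.ComplexMultiplication

end
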